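import Summits.CriticalPhenomena.SAWScalingLimit.Theorems.SAWMassiveIsingTiltLatticeUniversalityShiftedRelay
import Summits.CriticalPhenomena.SAWScalingLimit.Theorems.SAWMassiveIsingTiltLatticeUniversalityShiftedBdryEndpoints
import Summits.CriticalPhenomena.SAWScalingLimit.Theorems.SAWMassiveIsingTiltLatticeUniversalityMergingUpgrade
import HarnessLib

/-!
# Crux `LatticeUniversality` (stmt-CriticalPhenomena-0807), line `registered`: the relay composed from the
# ∀-form micro-robustness kernel (glue of skeleton v3.3/v3.4, `Cruxes/LatticeUniversality/Lines/birth.lean`)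

Line lead prover-line-stmt-CriticalPhenomena-0807-c2-0 (2026-08-17), continuing
`…LatticeUniversalityShiftedRelay.lean` (p144803, skeleton v3.2, lead c1). v3.3 cut c1's promoted ∃-form
research stub `stub_hexMicroRobust` into the existence of boundary mid-edge endpoint approximations for the
`O(δ)`-moving domains `D + u δ` (`stub_shiftedBdryEndpoints`, LANDED as
`…LatticeUniversalityShiftedBdryEndpoints.lean`, p147051) and the pure merging clause in ∀-FORM
(`stub_hexMicroRobustAll`: inner-cell vs vertex discretisation of one fixed domain on one lattice, endpoint
relocation to boundary triangles; bounded-Lipschitz merging for EVERY admissible boundary approximation of the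
moving face sets of `S_δ(D) = σD − iδ/2`; no limit assumed — the research kernel, no source).

This file proves, sorry-free (statements written out; no workfile-local definition in any header):
* `hexMicroRobust_of_allForm` — ∀-form kernel ⇒ c1's ∃-form `HexMicroRobust` (instantiate p147051 at `σD`,
  `u δ = −iδ/2`, admissible by `eventually_norm_halfShift_le`);
* `latticeUniversality_of_allFormRelay` — **the crux from exactly the four OPEN statements of the line**:
  `HexTight` (stmt-5423, hypothesis 1) → ∀-form micro-robustness (hypothesis 2) → robust transport `π/3 → π/2`
  (hypothesis 3; ⇐ 16995 ∧ 16963 by `thirdToSquareRobustBL_of_trackTransport`) → `YBtoUniform` (stmt-16966,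
  hypothesis 4) → `LatticeUniversality`, the merging upgrade being DISCHARGED by the landed `stub_mergingUpgrade`
  (p144690) and the endpoint existence by p147051.
Sources: A. Glazman, I. Manolescu, arXiv:1708.00395 §1 p. 3, Fig. 2, §4; H. Duminil-Copin et al. (DKKMO),
arXiv:2012.11672 Thm 2.1; A. D'Aristotile, P. Diaconis, D. Freedman, *On merging of probabilities* (1988).
-/

noncomputable section

namespace Summit.CriticalPhenomena.SAWScalingLimit.Cruxes.LatticeUniversality.Birth

open MeasureTheory Filter Topology Set
open scoped NNReal ENNReal BoundedContinuousFunction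
open Complex (I I_ne_zero)
open Literature.Probability.RandomPlanarGeometry
open Literature.Probability.RandomPlanarGeometry.SAW
open Literature.Probability.RandomPlanarGeometry.SAW.YangBaxter
open Literature.Probability.LatticeModels (Site HexVertex hexGraph hexCenter)
open Summit.CriticalPhenomena.SAWScalingLimit.Theses
open Summit.CriticalPhenomena.SAWScalingLimit.Cruxes.HexTransfer.YbRelay (third IsBdryEdge bdryVertex faceDomain)

/-- **The ∃-form micro-robustness (c1's `HexMicroRobust`) from the ∀-form kernel**: take the boundary
approximation of the moving domains `S_δ(D) = σD − iδ/2` given by the landed `stub_shiftedBdryEndpoints` (at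
`σD`, `u δ = −iδ/2`, admissible by `eventually_norm_halfShift_le`) and apply the ∀-form to it. Hypothesis =
registered stub `stub_hexMicroRobustAll` of skeleton v3.3, written out; conclusion = c1's registered (v3.2) stub
`stub_hexMicroRobust`, written out. [folklore] -/
theorem hexMicroRobust_of_allForm : (∀ (D : DobrushinDomain) (a b : ℝ → HexVertex), SAW.IsEmbEndpointApprox hexGraph hexCenter D a b → ∀ a' b' : ℝ → MidEdge, (∀ᶠ δ in 𝓝[>] (0 : ℝ), a' δ ≠ b' δ ∧ IsBdryEdge (meshFaces third (((D.map (similarity I I_ne_zero 0)).map (similarity 1 one_ne_zero (-(I * (δ : ℂ) / 2)))).carrier) δ) (a' δ) ∧ IsBdryEdge (meshFaces third (((D.map (similarity I I_ne_zero 0)).map (similarity 1 one_ne_zero (-(I * (δ : ℂ) / 2)))).carrier) δ) (b' δ) ∧ Nonempty (YangBaxterSAW third (((D.map (similarity I I_ne_zero 0)).map (similarity 1 one_ne_zero (-(I * (δ : ℂ) / 2)))).carrier) δ (a' δ) (b' δ))) → Tendsto (fun δ : ℝ => (δ : ℂ) * planeMidpoint third (a' δ)) (𝓝[>] (0 : ℝ))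 (𝓝 ((D.map (similarity I I_ne_zero 0)).pt 0)) → Tendsto (fun δ : ℝ => (δ : ℂ) * planeMidpoint third (b' δ)) (𝓝[>] (0 : ℝ)) (𝓝 ((D.map (similarity I I_ne_zero 0)).pt 1)) → ∀ f : BoundedContinuousFunction (CurveClass ℂ) ℝ, LipschitzWith 1 f → Tendsto (fun δ : ℝ => (∫ γ, f γ.curve ∂(SAW.hexSAWLaw (faceDomain (((D.map (similarity I I_ne_zero 0)).map (similarity 1 one_ne_zero (-(I * (δ : ℂ) / 2)))).carrier) δ (a' δ)) δ (bdryVertex (meshFaces third (((D.map (similarity I I_ne_zero 0)).map (similarity 1 one_ne_zero (-(I * (δ : ℂ) / 2)))).carrier) δ) (a' δ)) (bdryVertex (meshFaces third (((D.map (similarity I I_ne_zero 0)).map (similarity 1 one_ne_zero (-(I * (δ : ℂ) / 2)))).carrier) δ) (b' δ)))) - ∫ γ, f γ.curve ∂(SAW.hexSAWLaw D.carrier δ (a δ) (b δ))) (𝓝[>] (0 : ℝ)) (𝓝 0)) → ∀ (D : DobrushinDomain) (a b : ℝ → HexVertex), SAW.IsEmbEndpointApprox hexGraph hexCenter D a b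 → ∃ a' b' : ℝ → MidEdge, (∀ᶠ δ in 𝓝[>] (0 : ℝ), a' δ ≠ b' δ ∧ IsBdryEdge (meshFaces third (((D.map (similarity I I_ne_zero 0)).map (similarity 1 one_ne_zero (-(I * (δ : ℂ) / 2)))).carrier) δ) (a' δ) ∧ IsBdryEdge (meshFaces third (((D.map (similarity I I_ne_zero 0)).map (similarity 1 one_ne_zero (-(I * (δ : ℂ) / 2)))).carrier) δ) (b' δ) ∧ Nonempty (YangBaxterSAW third (((D.map (similarity I I_ne_zero 0)).map (similarity 1 one_ne_zero (-(I * (δ : ℂ) / 2)))).carrier) δ (a' δ) (b' δ))) ∧ Tendsto (fun δ : ℝ => (δ : ℂ) * planeMidpoint third (a' δ)) (𝓝[>] (0 : ℝ)) (𝓝 ((D.map (similarity I I_ne_zero 0)).pt 0)) ∧ Tendsto (fun δ : ℝ => (δ : ℂ) * planeMidpoint third (b' δ)) (𝓝[>] (0 : ℝ)) (𝓝 ((D.map (similarity I I_ne_zero 0)).pt 1)) ∧ ∀ f : BoundedContinuousFunction (CurveClass ℂ) ℝ, LipschitzWith 1 f → Tendsto (fun δ : ℝ => (∫ γ, f γ.curve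 ∂(SAW.hexSAWLaw (faceDomain (((D.map (similarity I I_ne_zero 0)).map (similarity 1 one_ne_zero (-(I * (δ : ℂ) / 2)))).carrier) δ (a' δ)) δ (bdryVertex (meshFaces third (((D.map (similarity I I_ne_zero 0)).map (similarity 1 one_ne_zero (-(I * (δ : ℂ) / 2)))).carrier) δ) (a' δ)) (bdryVertex (meshFaces third (((D.map (similarity I I_ne_zero 0)).map (similarity 1 one_ne_zero (-(I * (δ : ℂ) / 2)))).carrier) δ) (b' δ)))) - ∫ γ, f γ.curve ∂(SAW.hexSAWLaw D.carrier δ (a δ) (b δ))) (𝓝[>] (0 : ℝ)) (𝓝 0) := by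
  intro hK D a b hab
  obtain ⟨a', b', hev, ha', hb'⟩ := stub_shiftedBdryEndpoints (D.map (similarity I I_ne_zero 0))
    (fun δ : ℝ => -(I * (δ : ℂ) / 2)) eventually_norm_halfShift_le
  exact ⟨a', b', hev, ha', hb', hK D a b hab a' b' hev ha' hb'⟩

/-- **The crux from the four open statements of the line** (`HexTight` = stmt-5423 → ∀-form micro-robustness
→ robust transport `π/3 → π/2` → `YBtoUniform` = stmt-16966 → `LatticeUniversality`): the composition
`latticeUniversality_of_shiftedRelay` (p144803) with its micro-robustness hypothesis supplied by
`hexMicroRobust_of_allForm` and its merging-upgrade hypothesis discharged by the landed `stub_mergingUpgrade`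
(p144690). [folklore] -/
theorem latticeUniversality_of_allFormRelay : (∀ (D : DobrushinDomain) (a b : ℝ → HexVertex), SAW.IsEmbEndpointApprox hexGraph hexCenter D a b → IsTightAlongMesh (fun δ (γ : SAW.HexDomainSAW D.carrier δ (a δ) (b δ)) => γ.curve) (fun δ => SAW.hexSAWLaw D.carrier δ (a δ) (b δ))) → (∀ (D : DobrushinDomain) (a b : ℝ → HexVertex), SAW.IsEmbEndpointApprox hexGraph hexCenter D a b → ∀ a' b' : ℝ → MidEdge, (∀ᶠ δ in 𝓝[>] (0 : ℝ), a' δ ≠ b' δ ∧ IsBdryEdge (meshFaces third (((D.map (similarity I I_ne_zero 0)).map (similarity 1 one_ne_zero (-(I * (δ : ℂ) / 2)))).carrier) δ) (a' δ) ∧ IsBdryEdge (meshFaces third (((D.map (similarity I I_ne_zero 0)).map (similarity 1 one_ne_zero (-(I * (δ : ℂ) / 2)))).carrier) δ) (b' δ) ∧ Nonempty (YangBaxterSAW third (((D.map (similarity I I_ne_zero 0)).map (similarity 1 one_ne_zero (-(I * (δ : ℂ) / 2)))).carrier) δ (a' δ) (b' δ))) → Tendsto (fun δ : ℝ => (δ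 : ℂ) * planeMidpoint third (a' δ)) (𝓝[>] (0 : ℝ)) (𝓝 ((D.map (similarity I I_ne_zero 0)).pt 0)) → Tendsto (fun δ : ℝ => (δ : ℂ) * planeMidpoint third (b' δ)) (𝓝[>] (0 : ℝ)) (𝓝 ((D.map (similarity I I_ne_zero 0)).pt 1)) → ∀ f : BoundedContinuousFunction (CurveClass ℂ) ℝ, LipschitzWith 1 f → Tendsto (fun δ : ℝ => (∫ γ, f γ.curve ∂(SAW.hexSAWLaw (faceDomain (((D.map (similarity I I_ne_zero 0)).map (similarity 1 one_ne_zero (-(I * (δ : ℂ) / 2)))).carrier) δ (a' δ)) δ (bdryVertex (meshFaces third (((D.map (similarity I I_ne_zero 0)).map (similarity 1 one_ne_zero (-(I * (δ : ℂ) / 2)))).carrier) δ) (a' δ)) (bdryVertex (meshFaces third (((D.map (similarity I I_ne_zero 0)).map (similarity 1 one_ne_zero (-(I * (δ : ℂ) / 2)))).carrier) δ) (b' δ)))) - ∫ γ, f γ.curve ∂(SAW.hexSAWLaw D.carrier δ (a δ) (b δ))) (𝓝[>] (0 : ℝ)) (𝓝 0)) → (∀ (D : DobrushinDomain) (u : ℝ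 → ℂ) (a b : ℝ → MidEdge), (∀ᶠ δ in 𝓝[>] (0 : ℝ), ‖u δ‖ ≤ δ) → (∀ᶠ δ in 𝓝[>] (0 : ℝ), Nonempty (YangBaxterSAW (fun (_ : ℤ) => Real.pi / 3) ((D.map (similarity 1 one_ne_zero (u δ))).carrier) δ (a δ) (b δ))) → Tendsto (fun δ : ℝ => (δ : ℂ) * planeMidpoint (fun (_ : ℤ) => Real.pi / 3) (a δ)) (𝓝[>] (0 : ℝ)) (𝓝 (D.pt 0)) → Tendsto (fun δ : ℝ => (δ : ℂ) * planeMidpoint (fun (_ : ℤ) => Real.pi / 3) (b δ)) (𝓝[>] (0 : ℝ)) (𝓝 (D.pt 1)) → ∃ a' b' : ℝ → MidEdge, IsYBEndpointApprox (fun (_ : ℤ) => Real.pi / 2) D a' b' ∧ ∀ f : BoundedContinuousFunction (CurveClass ℂ) ℝ, LipschitzWith 1 f → Tendsto (fun δ : ℝ => (∫ γ, f (γ.curve (fun (_ : ℤ) => Real.pi / 3) δ) ∂(ybLaw (fun (_ : ℤ) => Real.pi / 3) ((D.map (similarity 1 one_ne_zero (u δ))).carrier) δ 1 (a δ) (b δ)))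 - ∫ γ, f (γ.curve (fun (_ : ℤ) => Real.pi / 2) δ) ∂(ybLaw (fun (_ : ℤ) => Real.pi / 2) D.carrier δ 1 (a' δ) (b' δ))) (𝓝[>] (0 : ℝ)) (𝓝 0)) → SAWTrackTransport.YBtoUniform → SAWMassiveIsingTilt.LatticeUniversality :=
  fun hT hK h2 h3 => latticeUniversality_of_shiftedRelay hT (hexMicroRobust_of_allForm hK) h2 h3 stub_mergingUpgrade

end Summit.CriticalPhenomena.SAWScalingLimit.Cruxes.LatticeUniversality.Birth

end
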